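import Summits.CriticalPhenomena.Ising3DConformalLimit.Theorems.HyperoctahedralRPExistsScaleCovariantLimitFoldedCurrentAvoidanceSublinear
import Summits.CriticalPhenomena.Ising3DConformalLimit.Theorems.HyperoctahedralRPExistsScaleCovariantLimitFoldedCurrentEngineIffDoubling
import HarnessLib

/-!
# Line `folded-current-repulsion`: the OVERSHOOT form of the engine — tripling ⟺ doubling, and its geometric reading

Lead `prover-line-stmt-CriticalPhenomena-1981-c11-0` (crux `ExistsScaleCovariantLimit`, stmt-CriticalPhenomena-1981). The engine F2
(`WallRepulsion` ⟺ item 6150, `wallRepulsion_iff_twoPointDoubling`) is an UPPER bound on an avoidance probability. Because the axis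
two-point function `g` is antitone (Messager–Miracle-Solé), all-scale DOUBLING `g(2k) ≥ κ g(k)` is the same as all-scale TRIPLING
`g(3k) ≥ κ' g(k)` (`tripling_iff_twoPointDoubling`, registered sub-goal), and by the overshoot dictionary (Aizenman's identity with the
near source at distance `j = k`, `tendsto_foldHitProb_dist`) the tripling ratio is a limiting CONNECTION probability:

  `P^{−2ke₀, −ke₀}_{Λ_L,β_c}[−ke₀ ⟷ 𝕏 folded] → g(3k)/g(k)`        (`foldHitProb_overshoot_tendsto`),

i.e. (after translating by `2ke₀`) the probability that the folded critical cluster sourced at `0, ke₀` reaches the plane `{x₀ = 2k}` at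
distance `k` BEYOND its near source. Hence F2 ⟺ a LOWER bound: the sourced critical cluster and its mirror image in that plane connect with
probability bounded below, uniformly in `k` (`twoPointDoubling_iff_eventually_overshoot`). This is the reflection-twin of Aizenman's intersection
criterion for `U₄ ≠ 0` (independent copy ↦ mirror copy), and the form a refuter should attack (slab CONFINEMENT of the sourced cluster along a
sequence of scales refutes 6150, hence the crux: `not_crux_of_overshoot_fails`).

References: M. Aizenman, Math. Phys. Anal. Geom. 28 (2025) 32, Thm 14.2; M. Aizenman, Comm. Math. Phys. 86 (1982) 1 (intersection criterion);
A. Messager, S. Miracle-Solé, J. Stat. Phys. 17 (1977).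
-/

noncomputable section

open Filter Topology
open Literature.Probability.LatticeModels
open Summit.CriticalPhenomena.Ising3DConformalLimit.Theses
open Classical

namespace Summit.CriticalPhenomena.Ising3DConformalLimit.Cruxes.ExistsScaleCovariantLimit.FoldedCurrentRepulsion

/-- **Tripling ⟺ doubling along the axis (registered sub-goal).** `(∃ κ > 0, ∀ k ≥ 1, κ g(k) ≤ g(3k)) ↔ TwoPointDoubling`:
`g(2k) ≥ g(3k)` and `g(3k) ≥ g(4k) ≥ κ² g(k)` by antitonicity (`Funnel.criticalTwoPoint_axis_antitone`). -/
theorem tripling_iff_twoPointDoubling :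
    (∃ κ : ℝ, 0 < κ ∧ ∀ k : ℕ, 1 ≤ k →
        κ * criticalTwoPoint 3 (Pi.single 0 (k : ℤ)) ≤ criticalTwoPoint 3 (Pi.single 0 ((3 * k : ℕ) : ℤ))) ↔
      MirrorHoelderCompactness.TwoPointDoubling := by
  have hanti := Funnel.criticalTwoPoint_axis_antitone (0 : Fin 3)
  constructor
  · rintro ⟨κ, hκ, h⟩
    refine ⟨κ, hκ, fun n hn => ?_⟩
    rw [Funnel.criticalTwoPoint_two_mul]
    exact (h n hn).trans (hanti (show 2 * n ≤ 3 * n by omega))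
  · rintro ⟨κ, hκ, h⟩
    refine ⟨κ * κ, mul_pos hκ hκ, fun k hk => ?_⟩
    have h1 := h k hk
    have h2 := h (2 * k) (by omega)
    rw [Funnel.criticalTwoPoint_two_mul] at h1 h2
    have h4 : criticalTwoPoint 3 (Pi.single 0 ((2 * (2 * k) : ℕ) : ℤ)) ≤ criticalTwoPoint 3 (Pi.single 0 ((3 * k : ℕ) : ℤ)) :=
      hanti (show 3 * k ≤ 2 * (2 * k) by omega)
    calc κ * κ * criticalTwoPoint 3 (Pi.single 0 (k : ℤ)) = κ * (κ * criticalTwoPoint 3 (Pi.single 0 (k : ℤ))) := by ring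
      _ ≤ κ * criticalTwoPoint 3 (Pi.single 0 ((2 * k : ℕ) : ℤ)) := mul_le_mul_of_nonneg_left h1 hκ.le
      _ ≤ criticalTwoPoint 3 (Pi.single 0 ((2 * (2 * k) : ℕ) : ℤ)) := h2
      _ ≤ criticalTwoPoint 3 (Pi.single 0 ((3 * k : ℕ) : ℤ)) := h4

/-- **The overshoot probability**: with far source `−2ke₀` and near source `−ke₀`, the folded hitting probability of `𝕏 = {x₀ = 0}`
(the plane at distance `k` BEYOND the near source) converges to the tripling ratio `g(3k)/g(k)` (the dictionary
`tendsto_foldHitProb_dist` at `j = k`). -/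
theorem foldHitProb_overshoot_tendsto (k : ℕ) (hk : 1 ≤ k) :
    Tendsto (fun L : ℕ => foldHitProb L (criticalBeta 3) (Pi.single 0 (-((k : ℤ) + k))) (Pi.single 0 (-(k : ℤ)))) atTop
      (𝓝 (criticalTwoPoint 3 (Pi.single 0 ((3 * k : ℕ) : ℤ)) / criticalTwoPoint 3 (Pi.single 0 (k : ℤ)))) := by
  have h := tendsto_foldHitProb_dist k k hk
  rwa [show k + 2 * k = 3 * k by ring] at h

/-- **Doubling ⟺ EVENTUAL OVERSHOOT in every large box**: item 6150 holds iff there is `κ > 0` such that for every `k ≥ 1`,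
eventually in `L`, the folded critical cluster sourced at `−2ke₀, −ke₀` reaches the mirror plane with probability `≥ κ`
(`⟹`: tripling with `κ²` and the limit `> κ²/2`; `⟸`: pass to the limit). -/
theorem twoPointDoubling_iff_eventually_overshoot :
    MirrorHoelderCompactness.TwoPointDoubling ↔
      ∃ κ : ℝ, 0 < κ ∧ ∀ k : ℕ, 1 ≤ k → ∀ᶠ L : ℕ in atTop,
        κ ≤ foldHitProb L (criticalBeta 3) (Pi.single 0 (-((k : ℤ) + k))) (Pi.single 0 (-(k : ℤ))) := by
  constructor
  · intro hD
    obtain ⟨κ, hκ, h⟩ := tripling_iff_twoPointDoubling.2 hD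
    refine ⟨κ / 2, by positivity, fun k hk => ?_⟩
    have hgk : 0 < criticalTwoPoint 3 (Pi.single 0 (k : ℤ)) := Funnel.criticalTwoPoint_axis_pos 0 k
    have hlt : κ / 2 < criticalTwoPoint 3 (Pi.single 0 ((3 * k : ℕ) : ℤ)) / criticalTwoPoint 3 (Pi.single 0 (k : ℤ)) := by
      rw [lt_div_iff₀ hgk]
      have := h k hk
      nlinarith
    exact ((foldHitProb_overshoot_tendsto k hk).eventually (lt_mem_nhds hlt)).mono fun L hL => hL.le
  · rintro ⟨κ, hκ, h⟩
    refine tripling_iff_twoPointDoubling.1 ⟨κ, hκ, fun k hk => ?_⟩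
    have hgk : 0 < criticalTwoPoint 3 (Pi.single 0 (k : ℤ)) := Funnel.criticalTwoPoint_axis_pos 0 k
    have hle : κ ≤ criticalTwoPoint 3 (Pi.single 0 ((3 * k : ℕ) : ℤ)) / criticalTwoPoint 3 (Pi.single 0 (k : ℤ)) :=
      ge_of_tendsto (foldHitProb_overshoot_tendsto k hk) (h k hk)
    rwa [le_div_iff₀ hgk] at hle

/-- **The refuter's entry point in overshoot form**: if for every `κ > 0` some scale `k ≥ 1` has the folded overshoot probability
`< κ` frequently in `L` (slab confinement of the sourced critical cluster), then the crux fails. -/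
theorem not_crux_of_overshoot_fails
    (h : ∀ κ : ℝ, 0 < κ → ∃ k : ℕ, 1 ≤ k ∧ ∃ᶠ L : ℕ in atTop,
      foldHitProb L (criticalBeta 3) (Pi.single 0 (-((k : ℤ) + k))) (Pi.single 0 (-(k : ℤ))) < κ) :
    ¬ Summit.CriticalPhenomena.Ising3DConformalLimit.Theses.HyperoctahedralRP.ExistsScaleCovariantLimit := by
  intro hc
  obtain ⟨κ, hκ, hall⟩ := twoPointDoubling_iff_eventually_overshoot.1 (Funnel.twoPointDoubling_of_crux hc)
  obtain ⟨k, hk, hfreq⟩ := h κ hκ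
  exact hfreq (by simpa using hall k hk)

end Summit.CriticalPhenomena.Ising3DConformalLimit.Cruxes.ExistsScaleCovariantLimit.FoldedCurrentRepulsion

end
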